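import Summits.NavierStokesRegularity.NavierStokesRegularity.Theorems.RellichScarSymmetricScarExistsApexScaleInvariantBoundsTimeDecay
import Literature.Analysis.FluidPDE.KNSSMildDecayProofs
import Literature.Analysis.FluidPDE.KNSSSmoothingHolds
import Mathlib.Analysis.Calculus.IteratedDeriv.Lemmas

/-!
# Crux `SymmetricScarExists` (stmt-NavierStokesRegularity-11718), line `logtime-bernoulli-certificate`:
# stub `stub_typeITimeDerivDecay` — decay at spatial infinity of the time derivatives of classical
# Type-I solutions

Helper file (`--supports stmt-NavierStokesRegularity-11718`; theorems only, no definitions, no named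
facts).  It proves the registered stub `stub_typeITimeDerivDecay`, which is LITERALLY the hypothesis `TD`
of the landed `stub_apexScaleInvariantBounds_ofTimeDerivDecay`
(`…ApexScaleInvariantBoundsTimeDecay.lean`): for a classical solution `(v, q)` of Navier–Stokes
(`ν = 1`, `f = 0`) on `(−∞,0) × ℝ³` with the Type-I bound `‖v(t,x)‖ ≤ C/(‖x‖ + √(−t))`, every iterated
time derivative `∂ₜʲv(·, y)` decays like `(1 + ‖y‖)^{−ε}` on each compact window `[t₁,t₂] ⊂ (−∞,0)`, for
some `ε = ε(j, window) > 0`.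

Proof (Koch–Nadirashvili–Seregin–Šverák 2009, Thm. 6.1 (mildness clause), Prop. 4.1, and
Landau–Kolmogorov interpolation in time), entirely from tree facts:

1. `typeI_oseenMild_window`: on a window `(a, T₁] ⊂ (−∞,0)` the solution is bounded (by `C/√(−T₁)`)
   and decays horizontally (`|x'| ‖v‖ ≤ ‖x‖ ‖v‖ ≤ C`), so by the tree's PROVED mildness clause of KNSS
   Thm. 6.1 (`KNSS2009_mild_of_rMulNorm_bounded_holds`: Lemma 3.1 + the decay kills the drift `b(t)`)
   it satisfies the Oseen integral equation `v(t) = e^{(t−s)Δ}v(s) − B¹_s(v,v)(t)` pointwise;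
2. `typeI_norm_iteratedDeriv_le`: KNSS Prop. 4.1 (`knss2009_smoothing_holds`, PROVED) bounds
   `(t−s)^l ‖∂ₜˡ(e^{(t−s)Δ}v(s) − B¹_s(v,v)(t))‖` on `(s, T₁) × ℝ³`; the right-hand side IS `v` there, so
   `∂ₜˡv` is bounded on every compact window (all `l`);
3. `stub_typeITimeDerivDecay`: induction on `j` with Landau's inequality on an interval
   (`norm_deriv_le_of_norm_le_of_norm_deriv_two_le`, landed): `∂ₜʲv = O((1+‖y‖)^{−ε})` on a larger
   window and `∂ₜ^{j+2}v = O(1)` give `∂ₜ^{j+1}v = O((1+‖y‖)^{−ε/2})`; `j = 0` is the Type-I bound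
   (`ε = 1`).

## References

* G. Koch, N. Nadirashvili, G. Seregin, V. Šverák, *Liouville theorems for the Navier–Stokes equations
  and applications*, Acta Math. 203 (2009) = arXiv:0709.3599, Lemma 3.1, Prop. 4.1, Thm. 6.1.
  [KochNadirashviliSereginSverak2009]
-/

noncomputable section

open MeasureTheory Set Function Filter Topology Metric
open scoped ContDiff ENNReal

namespace Summit.NavierStokesRegularity.NavierStokesRegularity.Theorems.SymmetricScarExists.LogtimeBernoulli

open Literature.Analysis
open Literature.Analysis.FluidPDE

section TypeITime

variable {v : ℝ → EuclideanSpace ℝ (Fin 3) → EuclideanSpace ℝ (Fin 3)}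
  {q : ℝ → EuclideanSpace ℝ (Fin 3) → ℝ} {C : ℝ}

/-- The constant of a Type-I bound `‖v(t,x)‖ ≤ C/(‖x‖+√(−t))` is nonnegative (evaluate at `t = −1`,
`x = 0`). [folklore] -/
theorem typeI_const_nonneg (hdec : HasTypeIDecay C v) : 0 ≤ C := by
  have h := hdec (-1) (by norm_num) 0
  rw [norm_zero, zero_add, neg_neg, Real.sqrt_one, div_one] at h
  exact (norm_nonneg _).trans h

/-- A Type-I solution is bounded by `C/√(−T₁)` on `(−∞, T₁] × ℝ³`, `T₁ < 0`. [folklore] -/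
theorem typeI_norm_le_of_le (hdec : HasTypeIDecay C v) {T₁ : ℝ} (hT₁ : T₁ < 0) {t : ℝ} (ht : t ≤ T₁)
    (x : EuclideanSpace ℝ (Fin 3)) : ‖v t x‖ ≤ C / Real.sqrt (-T₁) := by
  have hC := typeI_const_nonneg hdec
  have ht0 : t < 0 := lt_of_le_of_lt ht hT₁
  calc ‖v t x‖ ≤ C / (‖x‖ + Real.sqrt (-t)) := hdec t ht0 x
    _ ≤ C / Real.sqrt (-T₁) := by
        refine div_le_div_of_nonneg_left hC (Real.sqrt_pos.2 (by linarith)) ?_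
        calc Real.sqrt (-T₁) ≤ Real.sqrt (-t) := Real.sqrt_le_sqrt (by linarith)
          _ ≤ ‖x‖ + Real.sqrt (-t) := le_add_of_nonneg_left (norm_nonneg _)

/-- **A classical Type-I solution solves the Oseen integral equation on windows** (KNSS 2009,
Thm. 6.1, mildness clause, in the tree's proved form `KNSS2009_mild_of_rMulNorm_bounded_holds`): on
`(a, T₁] ⊂ (−∞, 0)` the solution is bounded by `C/√(−T₁)` and `|x'| ‖v(t,x)‖ ≤ ‖x‖ · C/(‖x‖+√(−t)) ≤ C`,
so `v(t, x) = e^{(t−s)Δ}v(s)(x) − B¹_s(v,v)(t)(x)` for all `a < s < t ≤ T₁` and all `x`.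
[cite: KochNadirashviliSereginSverak2009, Thm. 6.1 (mildness clause) with Lemma 3.1 (arXiv:0709.3599 pp. 7, 11–12)] -/
theorem typeI_oseenMild_window (hsol : IsClassicalNSSolutionOn (Iio 0) 1 0 v q)
    (hdec : HasTypeIDecay C v) {a T₁ : ℝ} (ha : a < T₁) (hT₁ : T₁ < 0) :
    ∀ ⦃s t : ℝ⦄, a < s → s < t → t ≤ T₁ → ∀ x : EuclideanSpace ℝ (Fin 3),
      v t x = UnboundedOperators.heatExtension (v s) (t - s) x - oseenDuhamel 1 s v v t x := by
  have hC := typeI_const_nonneg hdec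
  have hb : T₁ < T₁ / 2 := by linarith
  have hb0 : T₁ / 2 < 0 := by linarith
  have hcl : IsClassicalNSSolutionOn (Ioo a (T₁ / 2)) 1 0 v q :=
    hsol.mono (fun t ht => (ht.2.trans hb0 : t < 0)) (uniqueDiffOn_Ioo a (T₁ / 2))
  have hL : ∃ L : ℝ, ∀ t ∈ Ioc a T₁, ∀ x, ‖v t x‖ ≤ L :=
    ⟨C / Real.sqrt (-T₁), fun t ht x => typeI_norm_le_of_le hdec hT₁ ht.2 x⟩
  have hD : ∃ D : ℝ, ∀ t ∈ Ioc a T₁, ∀ x, cylRadius x * ‖v t x‖ ≤ D := by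
    refine ⟨C, fun t ht x => ?_⟩
    have ht0 : t < 0 := lt_of_le_of_lt ht.2 hT₁
    have hσ : 0 < Real.sqrt (-t) := Real.sqrt_pos.2 (by linarith)
    have hden : 0 < ‖x‖ + Real.sqrt (-t) := by positivity
    calc cylRadius x * ‖v t x‖ ≤ ‖x‖ * (C / (‖x‖ + Real.sqrt (-t))) :=
          mul_le_mul (SereginSverak2009.cylRadius_le_norm' x) (hdec t ht0 x) (norm_nonneg _)
            (norm_nonneg _)
      _ = C * (‖x‖ / (‖x‖ + Real.sqrt (-t))) := by ring
      _ ≤ C * 1 := by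
          refine mul_le_mul_of_nonneg_left ?_ hC
          rw [div_le_one hden]
          linarith
      _ = C := mul_one C
  exact KNSS2009_mild_of_rMulNorm_bounded_holds hcl ha hb hL hD

/-- **The time derivatives of a classical Type-I solution are bounded on compact windows** (KNSS 2009,
Prop. 4.1 in the tree's proved form `knss2009_smoothing_holds`, applied to the Oseen representation of
`typeI_oseenMild_window` from the time `s = t₁ − 1`): for every `l` and every `[t₁,t₂] ⊂ (−∞,0)` there
is `B` with `‖∂ₜˡv(t, y)‖ ≤ B` on `[t₁,t₂] × ℝ³` (the smooth representative
`e^{(t−s)Δ}v(s) − B¹_s(v,v)(t)` of Prop. 4.1 coincides with `v` on `(s, t₂/2) × ℝ³`, and its weighted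
bound `(t−s)^l ‖∂ₜˡ·‖ ≤ B` has weight `≥ 1` on the window).
[cite: KochNadirashviliSereginSverak2009, Prop. 4.1 (arXiv:0709.3599 p. 8)] -/
theorem typeI_norm_iteratedDeriv_le (hsol : IsClassicalNSSolutionOn (Iio 0) 1 0 v q)
    (hdec : HasTypeIDecay C v) (l : ℕ) {t₁ t₂ : ℝ} (h12 : t₁ < t₂) (h2 : t₂ < 0) :
    ∃ B : ℝ, ∀ t ∈ Icc t₁ t₂, ∀ y : EuclideanSpace ℝ (Fin 3),
      ‖iteratedDeriv l (fun s => v s y) t‖ ≤ B := by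
  set s : ℝ := t₁ - 1 with hs
  set T₁ : ℝ := t₂ / 2 with hT₁
  have hst₁ : s < t₁ := by rw [hs]; linarith
  have h2T₁ : t₂ < T₁ := by rw [hT₁]; linarith
  have hT₁0 : T₁ < 0 := by rw [hT₁]; linarith
  have hsT₁ : s < T₁ := by linarith
  have hs0 : s < 0 := by linarith
  -- the Oseen representation from the time `s`
  have hmild := typeI_oseenMild_window hsol hdec (a := s - 1) (T₁ := T₁) (by linarith) hT₁0
  have hmild' : ∀ t ∈ Ioo s T₁, ∀ x,
      v t x = UnboundedOperators.heatExtension (v s) (1 * (t - s)) x - oseenDuhamel 1 s v v t x := by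
    intro t ht x
    rw [one_mul]
    exact hmild (by linarith) ht.1 ht.2.le x
  -- bounds and measurability
  set L : ℝ := C / Real.sqrt (-T₁) with hL
  have hL0 : 0 ≤ L := div_nonneg (typeI_const_nonneg hdec) (Real.sqrt_nonneg _)
  have hLb : ∀ t ≤ T₁, ∀ x, ‖v t x‖ ≤ L := fun t ht x => typeI_norm_le_of_le hdec hT₁0 ht x
  have hnorm : ∀ t ≤ T₁, eLpNorm (v t) ∞ volume ≤ ENNReal.ofReal L := by
    intro t ht
    rw [eLpNorm_exponent_top]
    exact eLpNormEssSup_le_of_ae_bound (Eventually.of_forall fun x => hLb t ht x)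
  have hcont : ContinuousOn (uncurry v) (Iio 0 ×ˢ univ) := hsol.smooth_velocity.continuousOn
  have hmeas_a : AEStronglyMeasurable (v s) volume :=
    (hsol.contDiff_velocity hs0).continuous.aestronglyMeasurable
  have hmeas : AEStronglyMeasurable (uncurry v)
      ((volume : Measure (ℝ × EuclideanSpace ℝ (Fin 3))).restrict (Ioo s T₁ ×ˢ univ)) :=
    (hcont.mono (prod_mono (fun τ hτ => (hτ.2.trans hT₁0 : τ < 0)) Subset.rfl)).aestronglyMeasurable
      (measurableSet_Ioo.prod MeasurableSet.univ)
  -- KNSS Prop. 4.1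
  obtain ⟨-, -, hbds⟩ := knss2009_smoothing_holds (EuclideanSpace ℝ (Fin 3)) one_pos hsT₁ hL0 hmeas_a
    (hnorm s hsT₁.le) hmeas (fun t ht => hnorm t ht.2.le)
    (fun t ht => Eventually.of_forall fun x => hmild' t ht x)
  obtain ⟨B, hB⟩ := hbds 0 l
  refine ⟨B, fun t ht y => ?_⟩
  have htI : t ∈ Ioo s T₁ := ⟨by linarith [ht.1], by linarith [ht.2]⟩
  have key := hB t htI y
  rw [norm_iteratedFDeriv_zero] at key
  -- the representative is `v` near `t`
  have heq : (fun τ => UnboundedOperators.heatExtension (v s) (1 * (τ - s)) y - oseenDuhamel 1 s v v τ y)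
      =ᶠ[𝓝 t] fun τ => v τ y := by
    filter_upwards [Ioo_mem_nhds htI.1 htI.2] with τ hτ
    exact (hmild' τ hτ y).symm
  rw [heq.iteratedDeriv_eq l] at key
  have hts : 1 ≤ t - s := by rw [hs]; linarith [ht.1]
  have hpow : 1 ≤ (t - s) ^ (((0 : ℕ) : ℝ) / 2 + (l : ℝ)) := Real.one_le_rpow hts (by positivity)
  exact (le_mul_of_one_le_left (norm_nonneg _) hpow).trans key

end TypeITime

/-- **Registered stub `stub_typeITimeDerivDecay`: the iterated time derivatives of a classical Type-I
solution decay at spatial infinity on compact windows.**  For every classical solution `(v, q)` of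
Navier–Stokes (`ν = 1`, `f = 0`) on `(−∞,0) × ℝ³` with `‖v(t,x)‖ ≤ C/(‖x‖+√(−t))`, every `j` and every
window `[t₁,t₂] ⊂ (−∞,0)`, there are `ε > 0` and `M` with `(1+‖y‖)^ε ‖∂ₜʲv(t,y)‖ ≤ M` on
`[t₁,t₂] × ℝ³`.  Induction on `j`: `j = 0` is the Type-I bound with `ε = 1`
(`(1+‖y‖)/(‖y‖+√(−t)) ≤ 1 + 1/√(−t₂)`); the step is Landau's inequality on `[t₁−1, t₂/2]`
(`norm_deriv_le_of_norm_le_of_norm_deriv_two_le` with `h = ((b−a)/2)(1+‖y‖)^{−ε/2}`) between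
`‖∂ₜʲv‖ ≤ M(1+‖y‖)^{−ε}` (induction hypothesis) and `‖∂ₜ^{j+2}v‖ ≤ B`
(`typeI_norm_iteratedDeriv_le`, KNSS 2009 Prop. 4.1 + Thm. 6.1), which yields
`(1+‖y‖)^{ε/2}‖∂ₜ^{j+1}v‖ ≤ 4M/(b−a) + B(b−a)`.
[cite: KochNadirashviliSereginSverak2009, Prop. 4.1 and Thm. 6.1 (arXiv:0709.3599 pp. 8, 11–12)] -/
theorem stub_typeITimeDerivDecay :
    ∀ (v : ℝ → EuclideanSpace ℝ (Fin 3) → EuclideanSpace ℝ (Fin 3)) (q : ℝ → EuclideanSpace ℝ (Fin 3) → ℝ) (C : ℝ), Literature.Analysis.FluidPDE.IsClassicalNSSolutionOn (Set.Iio 0) 1 0 v q → Literature.Analysis.FluidPDE.HasTypeIDecay C v → ∀ (j : ℕ) (t₁ t₂ : ℝ), t₁ < t₂ → t₂ < 0 → ∃ (ε M : ℝ), 0 < ε ∧ ∀ t ∈ Set.Icc t₁ t₂, ∀ (y : EuclideanSpace ℝ (Fin 3)), (1 + ‖y‖) ^ ε * ‖iteratedDeriv j (fun s => v s y) t‖ ≤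 M := by
  intro v q C hsol hdec
  have hC : 0 ≤ C := typeI_const_nonneg hdec
  -- the iterated time derivatives as space–time fields
  set G : ℕ → ℝ → (EuclideanSpace ℝ (Fin 3)) → EuclideanSpace ℝ (Fin 3) := fun i t y =>
    iteratedDeriv i (fun s => v s y) t with hG
  have hG0 : G 0 = v := by
    funext t y; simp only [hG, iteratedDeriv_zero]
  have hGsucc : ∀ i, G (i + 1) = fun t y => deriv (fun s => G i s y) t := by
    intro i; funext t y; simp only [hG, iteratedDeriv_succ]
  have hGsm : ∀ i, IsSmoothSpaceTimeOn (Iio 0) (G i) := by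
    intro i
    induction i with
    | zero => rw [hG0]; exact hsol.smooth_velocity
    | succ i ih => rw [hGsucc i]; exact ih.isSmoothSpaceTimeOn_deriv isOpen_Iio
  have hGderiv : ∀ i, ∀ t < (0 : ℝ), ∀ y, HasDerivAt (fun s => G i s y) (G (i + 1) t y) t := by
    intro i t ht y
    have h := (hGsm i).hasDerivAt_timeLine isOpen_Iio ht y
    rw [hGsucc i]
    exact h
  intro j
  induction j with
  | zero =>
    intro t₁ t₂ h12 h2
    set σ₂ : ℝ := Real.sqrt (-t₂) with hσ₂
    have hσ₂0 : 0 < σ₂ := Real.sqrt_pos.2 (by linarith)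
    refine ⟨1, C * (1 + 1 / σ₂), one_pos, fun t ht y => ?_⟩
    have ht0 : t < 0 := lt_of_le_of_lt ht.2 h2
    set σ : ℝ := Real.sqrt (-t) with hσ
    have hσ0 : 0 < σ := Real.sqrt_pos.2 (by linarith)
    have hσle : σ₂ ≤ σ := Real.sqrt_le_sqrt (by linarith [ht.2])
    have hden : 0 < ‖y‖ + σ := by positivity
    rw [Real.rpow_one, iteratedDeriv_zero]
    have h1 : 1 ≤ σ / σ₂ := (one_le_div hσ₂0).2 hσle
    have hcmp : 1 + ‖y‖ ≤ (1 + 1 / σ₂) * (‖y‖ + σ) := by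
      have e : (1 + 1 / σ₂) * (‖y‖ + σ) = ‖y‖ + σ + ‖y‖ / σ₂ + σ / σ₂ := by ring
      rw [e]
      have : 0 ≤ ‖y‖ / σ₂ := by positivity
      linarith [hσ0.le]
    calc (1 + ‖y‖) * ‖v t y‖ ≤ (1 + ‖y‖) * (C / (‖y‖ + σ)) :=
          mul_le_mul_of_nonneg_left (hdec t ht0 y) (by positivity)
      _ = C * ((1 + ‖y‖) / (‖y‖ + σ)) := by ring
      _ ≤ C * (1 + 1 / σ₂) := by
          refine mul_le_mul_of_nonneg_left ?_ hC
          rwa [div_le_iff₀ hden]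
  | succ j ih =>
    intro t₁ t₂ h12 h2
    set a : ℝ := t₁ - 1 with ha
    set b : ℝ := t₂ / 2 with hb
    have hat₁ : a < t₁ := by rw [ha]; linarith
    have h2b : t₂ < b := by rw [hb]; linarith
    have hb0 : b < 0 := by rw [hb]; linarith
    have hab : a < b := by linarith
    have hba : 0 < b - a := sub_pos.2 hab
    obtain ⟨ε, M, hε, hM⟩ := ih a b hab hb0
    obtain ⟨B, hB⟩ := typeI_norm_iteratedDeriv_le hsol hdec (j + 2) hab hb0
    refine ⟨ε / 2, 4 * M / (b - a) + B * (b - a), half_pos hε, fun t ht y => ?_⟩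
    have htab : t ∈ Icc a b := ⟨by linarith [ht.1], by linarith [ht.2]⟩
    set w : ℝ := 1 + ‖y‖ with hw
    have hw1 : 1 ≤ w := by rw [hw]; linarith [norm_nonneg y]
    have hw0 : 0 < w := by linarith
    set r : ℝ := w ^ (-(ε / 2)) with hr
    have hr0 : 0 < r := Real.rpow_pos_of_pos hw0 _
    have hr2 : r ^ 2 = w ^ (-ε) := by
      rw [hr, ← Real.rpow_natCast, ← Real.rpow_mul hw0.le]
      norm_num
    have hwr : w ^ (ε / 2) = r⁻¹ := by
      rw [hr, Real.rpow_neg hw0.le, inv_inv]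
    -- the three functions of Landau's inequality
    have hA : ∀ s ∈ Icc a b, ‖G j s y‖ ≤ M * r ^ 2 := by
      intro s hs
      have h := hM s hs y
      have hpos : 0 < w ^ ε := Real.rpow_pos_of_pos hw0 ε
      rw [hr2, Real.rpow_neg hw0.le, ← div_eq_mul_inv, le_div_iff₀ hpos, mul_comm]
      exact h
    have hBB : ∀ s ∈ Icc a b, ‖G (j + 2) s y‖ ≤ B := fun s hs => hB s hs y
    have hf : ∀ s ∈ Icc a b, HasDerivAt (fun τ => G j τ y) (G (j + 1) s y) s := fun s hs =>
      hGderiv j s (lt_of_le_of_lt hs.2 hb0) y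
    have hf' : ∀ s ∈ Icc a b, HasDerivAt (fun τ => G (j + 1) τ y) (G (j + 2) s y) s := fun s hs =>
      hGderiv (j + 1) s (lt_of_le_of_lt hs.2 hb0) y
    -- the step `h = ((b - a)/2) r`
    have hr1 : r ≤ 1 := by
      rw [hr, Real.rpow_neg hw0.le]
      exact inv_le_one_of_one_le₀ (Real.one_le_rpow hw1 (by positivity))
    have hh : 0 < (b - a) / 2 * r := by positivity
    have hh2 : 2 * ((b - a) / 2 * r) ≤ b - a := by nlinarith
    have key := norm_deriv_le_of_norm_le_of_norm_deriv_two_le hf hf' hA hBB hh hh2 htab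
    have e : 2 * (M * r ^ 2) / ((b - a) / 2 * r) + 2 * B * ((b - a) / 2 * r) =
        (4 * M / (b - a) + B * (b - a)) * r := by
      field_simp
      ring
    rw [e] at key
    show w ^ (ε / 2) * ‖G (j + 1) t y‖ ≤ 4 * M / (b - a) + B * (b - a)
    rw [hwr]
    calc r⁻¹ * ‖G (j + 1) t y‖ ≤ r⁻¹ * ((4 * M / (b - a) + B * (b - a)) * r) :=
          mul_le_mul_of_nonneg_left key (inv_nonneg.2 hr0.le)
      _ = 4 * M / (b - a) + B * (b - a) := by field_simp

end Summit.NavierStokesRegularity.NavierStokesRegularity.Theorems.SymmetricScarExists.LogtimeBernoulli
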